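import Summits.ResolutionOfSingularities.ResolutionOfSingularities.Theorems.FrobeniusClosingPatchingRelPerfectDepthSepPeelStep
import Summits.ResolutionOfSingularities.ResolutionOfSingularities.Theorems.FrobeniusClosingPatchingRelPerfectDepthSepTargets
import HarnessLib

/-!
# Crux `PatchingRelPerfect` (stmt-ResolutionOfSingularities-16161), chain W5.2 — F6 STAGE 2, target T6-E2 `SeparationBoundary₃`
# (TargetsF6 v1.2, `…DepthSepTargets`): PHASE B «PEEL-ALL» — from the MID state every component is peeled off, the END is reached with
# `𝔟 = ⊤`, and T6-E2 follows from PHASE A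

[OURS · L1 W5.2 · rung tool] Replaces the role of NO printed item; NOT a statement of the manuscript under review; fact-free; AI-written
(AI review is weaker than expert review).

THE ROUTE OF T6-E2 (res-L1-w52-plan-1 g8 RULING R2a 10:19:07Z; holders: Phase A res-D-pv-054, Phase B + composition
res-L1-w52-stub-1).  On the regular excellent threefold `E` carrying the non-zero locally principal E-side datum `𝔟` of a
non-graded depth-two member after stage 1 (host regular along `E`, boundary EMPTY), PHASE A runs Cossart–Jannsen–Saito with empty
boundary on `V(𝔟)_red` and transports it into `DepthTargets.IsSepSeq` (every centre of order `≥ 2`: no JOINT owed), reaching a MID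
state on `E'`: `𝔟' = monomialIdeal 𝒮` for a list `𝒮` of members (with multiplicities) of ONE snc family `𝓔₀` that also contains every
boundary trace, the members of `𝒮` having connected supports.  PHASE B (this file) then PEELS: each member `S` of `𝒮` is blown up
`e_S` times — every peel is the identity of `E'` (`DepthSep.isBlowup_id_of_mem`) and a legal `IsSepSeq.cons`
(`isSepSeq_peel`: regular connected centre `S ⊇ V(𝔟')`… i.e. `𝔟' ≤ S`; snc and uniform incidence with the boundary from the snc
chart; JOINT at the order-one points `z ∈ V(S)` because there `𝔟'_z = S_z` — `CoincidesAt` if `S` is a trace, else the chart of `𝓔₀`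
serves `𝔟' :: chargedOf 𝒟'` with centre `S`); the ideal becomes `(𝔟' : S)` (one exponent off, `colon_monomialIdeal_cons_succ`) and
`S` joins the boundary with N-exponent `w_𝒟'(S) + 1`.  When `𝒮` is exhausted `𝔟 = ⊤`: the host and `E` are DISJOINT, and
`EndSep ⊤ _` holds vacuously (`endSep_top`) — complete separation is the END (res-L1-w52-stub-1 (R1) 09:49:43Z; the X-side then
reads `EndTwoMonomialSep` at the pockets only).

* §1 `isSepSeq_peel` — one peel is a step;
* §2 `exists_isSepSeq_top_of_monomial` — PEEL-ALL by induction on the list `𝒮` and on the head exponent (members `⊤` and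
  exponents `0` skipped), accumulator form (the scheme `E'` is fixed);
* §3 `endSep_top`, **`exists_isSepSeq_endSep_of_mid`** (MID ⇒ END; the interface res-D-pv-054's Phase A targets);
* §4 **`exists_isSepSeq_endSep_of_phaseA`** — T6-E2's matrix (`SeparationBoundary₃` of TargetsF6 v1.2 at `𝒟 = []`) from the
  Phase-A output stated as an explicit hypothesis `hA`; the by-name closer `separationBoundary₃_holds` is the two-line composition with
  Phase A's producer (separate module).

## References
* J. Kollár, *Lectures on Resolution of Singularities* (2007), (3.111) Step 3 (blowing up the divisors of the monomial part). [Kollar2007]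
* V. Cossart, U. Jannsen, S. Saito, LNM 2270 (2020), Thm. 1.4 (embedded resolution of excellent surfaces; the Phase-A driver,
  as a hypothesis). [CossartJannsenSaito2020]
* U. Görtz, T. Wedhorn, *Algebraic Geometry I* (2020), (13.19) p. 413 (blow-up of an effective Cartier divisor). [GortzWedhorn2020]
-/

-- `Summit.<Summit>.<Sub>.Theorems` with `Sub = Summit` (single-conjunct summit, D-0017)
set_option linter.dupNamespace false

noncomputable section

open CategoryTheory AlgebraicGeometry TopologicalSpace IsLocalRing
open Literature.AlgebraicGeometry.Resolution

namespace Summit.ResolutionOfSingularities.ResolutionOfSingularities.Theorems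

universe u


/-! ## §1 One peel is a step of `IsSepSeq` -/

namespace DepthSep

open DepthTargets

variable {E' E : Scheme.{u}}

/-- A charged member is a boundary member. [folklore] -/
theorem mem_boundaryOf_of_mem_chargedOf {𝒟 : List (E'.IdealSheafData × ℕ)} {D : E'.IdealSheafData}
    (hD : D ∈ chargedOf 𝒟) : D ∈ boundaryOf 𝒟 := by
  obtain ⟨p, hp, rfl⟩ := List.mem_map.mp hD
  exact fst_mem_boundaryOf (List.mem_filter.mp hp).1

/-- **ONE PEEL IS A LEGAL STEP.**  At a state `(𝔟, 𝒟)` of an `IsSepSeq` on `E'`, let `𝓔` be an snc family on `E'` containing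
every boundary member, and `S ∈ 𝓔` a member with connected support and `𝔟 ≤ S`.  Then blowing up `S` — the identity of
`E'` — extends the sequence, with new state `((𝔟 : S), 𝒟ˢᵗ ++ [(S, w_𝒟(S) + 1)])`.  The clauses: `V(S)` regular
(`HasSNCWith.isRegular_subscheme`); connected (hypothesis); `𝔟 ≤ S` (hypothesis); snc / uniform incidence of the boundary with
`S` (sub-family of `𝓔`, incomparable stalks of distinct members); JOINT at a point `z ∈ V(S)` of order one: `𝔟_z = S_z`, so
either `S` is a boundary member (`CoincidesAt`) or `S ∉ boundaryOf 𝒟 ⊇ chargedOf 𝒟` and the snc chart of `𝓔` at `z` serves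
`𝔟 :: chargedOf 𝒟` with centre `S`. [cite: Kollar2007, (3.111) Step 3] [cite: GortzWedhorn2020, (13.19) p. 413] -/
theorem isSepSeq_peel [IsLocallyNoetherian E'] {ρ : E' ⟶ E} {𝔟₀ : E.IdealSheafData} {𝒟₀ : List (E.IdealSheafData × ℕ)}
    {𝓔 : List E'.IdealSheafData} (h𝓔 : HasSNC 𝓔) {S : E'.IdealSheafData} (hS : S ∈ 𝓔)
    (hSc : _root_.IsPreconnected (S.support : Set E'))
    {𝔟 : E'.IdealSheafData} (h𝔟S : 𝔟 ≤ S) {𝒟 : List (E'.IdealSheafData × ℕ)} (h𝒟 : ∀ D ∈ boundaryOf 𝒟, D ∈ 𝓔)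
    (hseq : IsSepSeq ρ 𝔟₀ 𝒟₀ 𝔟 𝒟) :
    IsSepSeq (𝟙 E' ≫ ρ) 𝔟₀ 𝒟₀ (colon 𝔟 S)
      (𝒟.map (fun p => (strictTransformIdeal (𝟙 E') S p.1, p.2)) ++
        [(S.comap (𝟙 E'), weightOf 𝒟 (divisorsOver 𝒟 S S.support) + 1)]) := by
  have hES : HasSNCWith 𝓔 S := h𝓔.hasSNCWith_of_mem hS
  have hjoint : ∀ z : E', z ∈ S.support → OrdLeOneAt 𝔟 z → SepJointAt 𝔟 S 𝒟 z := by
    intro z hz hord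
    obtain ⟨s, -, -, hs⟩ := h𝓔.exists_generator_of_mem hS hz
    have heq : stalkIdeal 𝔟 z = stalkIdeal S z := stalkIdeal_eq_of_le_of_not_le_sq h𝔟S hz ⟨s, hs⟩ hord
    by_cases hSD : S ∈ boundaryOf 𝒟
    · exact Or.inl ⟨S, hSD, hz, heq.symm⟩
    · refine Or.inr (sncWithAt_cons_of_stalkIdeal_eq ?_ hz heq fun h => hSD (mem_boundaryOf_of_mem_chargedOf h))
      exact sncWithAt_cons_self h𝓔 (fun D hD => h𝒟 D (mem_boundaryOf_of_mem_chargedOf hD)) hS z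
  have h := IsSepSeq.cons (𝟙 E') ρ 𝔟₀ 𝒟₀ 𝔟 𝒟 S hseq hES.isRegular_subscheme hSc h𝔟S
    (hasSNCWith_of_subset_of_mem h𝓔 h𝒟 hS)
    (uniformPieces_single_of_hasSNC (h𝓔.of_subset fun D hD =>
      (List.mem_cons.mp hD).elim (fun h => h ▸ hS) (h𝒟 D)))
    hjoint (isBlowup_id_of_mem h𝓔 hS)
  rwa [controlledTransform_id] at h

/-! ## §2 PEEL-ALL: the induction on the total multiplicity -/

/-- The unit ideal contributes nothing to a monomial ideal: `⊤^e · Π = Π`. [folklore] -/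
theorem monomialIdeal_cons_top (e : ℕ) (𝒮 : List (E'.IdealSheafData × ℕ)) :
    monomialIdeal (((⊤ : E'.IdealSheafData), e) :: 𝒮) = monomialIdeal 𝒮 := by
  rw [monomialIdeal_cons, ← Scheme.IdealSheafData.one_eq_top, one_pow, one_mul]

/-- **PHASE B «PEEL-ALL» (accumulator form).**  Let `𝓔` be an snc family on the locally Noetherian `E'` containing `⊤`, and
let the current state of an `IsSepSeq` be `(monomialIdeal 𝒮, 𝒟)` with the members of `𝒮` in `𝓔` with connected supports and
the boundary drawn from `𝓔`.  Peeling the members of `𝒮` one exponent at a time (each peel the identity of `E'`,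
`isSepSeq_peel`; `(S^{e+1}·Π : S) = S^e·Π`, `colon_monomialIdeal_cons_succ`) extends the sequence to the state `𝔟 = ⊤`, with the
boundary still drawn from `𝓔`.  Induction on the list and on the head exponent; members `= ⊤` and exponents `0` are skipped.
[cite: Kollar2007, (3.111) Step 3] -/
theorem exists_isSepSeq_top_of_monomial [IsLocallyNoetherian E'] {𝓔 : List E'.IdealSheafData} (h𝓔 : HasSNC 𝓔)
    (htop : (⊤ : E'.IdealSheafData) ∈ 𝓔) {𝔟₀ : E.IdealSheafData} {𝒟₀ : List (E.IdealSheafData × ℕ)} :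
    ∀ (𝒮 : List (E'.IdealSheafData × ℕ)),
      (∀ p ∈ 𝒮, p.1 ∈ 𝓔 ∧ _root_.IsPreconnected (p.1.support : Set E')) →
      ∀ {ρ : E' ⟶ E} {𝒟 : List (E'.IdealSheafData × ℕ)}, (∀ D ∈ boundaryOf 𝒟, D ∈ 𝓔) →
        IsSepSeq ρ 𝔟₀ 𝒟₀ (monomialIdeal 𝒮) 𝒟 →
        ∃ (ρ' : E' ⟶ E) (𝒟' : List (E'.IdealSheafData × ℕ)),
          (∀ D ∈ boundaryOf 𝒟', D ∈ 𝓔) ∧ IsSepSeq ρ' 𝔟₀ 𝒟₀ ⊤ 𝒟' := by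
  intro 𝒮
  induction 𝒮 with
  | nil =>
    intro _ ρ 𝒟 h𝒟 hseq
    exact ⟨ρ, 𝒟, h𝒟, by simpa only [monomialIdeal_nil] using hseq⟩
  | cons p 𝒮 ih =>
    obtain ⟨S, e⟩ := p
    intro h𝒮 ρ 𝒟 h𝒟 hseq
    have hS𝓔 : S ∈ 𝓔 := (h𝒮 (S, e) List.mem_cons_self).1
    have hSc : _root_.IsPreconnected (S.support : Set E') := (h𝒮 (S, e) List.mem_cons_self).2
    have htail : ∀ q ∈ 𝒮, q.1 ∈ 𝓔 ∧ _root_.IsPreconnected (q.1.support : Set E') :=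
      fun q hq => h𝒮 q (List.mem_cons_of_mem _ hq)
    clear h𝒮
    -- skip the unit ideal
    by_cases hST : S = ⊤
    · subst hST
      rw [monomialIdeal_cons_top] at hseq
      exact ih htail h𝒟 hseq
    -- peel the head `e` times
    induction e generalizing ρ 𝒟 with
    | zero =>
      rw [monomialIdeal_cons_zero] at hseq
      exact ih htail h𝒟 hseq
    | succ e ihe =>
      have hle : monomialIdeal ((S, e + 1) :: 𝒮) ≤ S :=
        monomialIdeal_le_of_mem List.mem_cons_self (Nat.le_add_left 1 e)
      have hstep := isSepSeq_peel h𝓔 hS𝓔 hSc hle h𝒟 hseq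
      rw [colon_monomialIdeal_cons_succ ((h𝓔.hasSNCWith_of_mem hS𝓔).isEffectiveCartier_of_mem hS𝓔)] at hstep
      refine ihe (fun D hD => ?_) hstep
      exact (mem_or_eq_top_of_mem_boundaryOf_peel h𝓔 hS𝓔 h𝒟 _ hD).elim id fun h => by rw [h]; exact htop

/-! ## §3 The END with `𝔟 = ⊤`, and the MID ⇒ END packaging -/

/-- **`EndSep ⊤ 𝒟` holds vacuously** (the unit ideal has empty support): complete separation is a legal END of stage 2.
[folklore] -/
theorem endSep_top (𝒟 : List (E'.IdealSheafData × ℕ)) : EndSep (⊤ : E'.IdealSheafData) 𝒟 := by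
  intro x hx
  rw [Scheme.IdealSheafData.support_top] at hx
  exact absurd hx id

/-- **MID ⇒ END (T6-E2 Phase B).**  Let `𝓔₀` be an snc family on the locally Noetherian `E'`; suppose an `IsSepSeq` from
`(𝔟₀, 𝒟₀)` on `E` has reached on `E'` a state whose ideal is a MONOMIAL `Π S_j^{e_j}` in members `S_j ∈ 𝓔₀` with connected
supports and whose boundary is drawn from `𝓔₀ ∪ {⊤}` (the MID state delivered by Phase A: Cossart–Jannsen–Saito + splitting).
Then the sequence extends — by peels only, all on `E'` — to a state `(⊤, 𝒟')`, at which `EndSep` holds; the final boundary is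
again drawn from `𝓔₀ ∪ {⊤}`. [cite: Kollar2007, (3.111) Step 3] [cite: CossartJannsenSaito2020, Thm. 1.4] -/
theorem exists_isSepSeq_endSep_of_mid [IsLocallyNoetherian E'] {𝓔₀ : List E'.IdealSheafData} (h𝓔₀ : HasSNC 𝓔₀)
    {𝔟₀ : E.IdealSheafData} {𝒟₀ : List (E.IdealSheafData × ℕ)} (𝒮 : List (E'.IdealSheafData × ℕ))
    (h𝒮 : ∀ p ∈ 𝒮, p.1 ∈ 𝓔₀ ∧ _root_.IsPreconnected (p.1.support : Set E'))
    {ρ : E' ⟶ E} {𝒟 : List (E'.IdealSheafData × ℕ)} (h𝒟 : ∀ D ∈ boundaryOf 𝒟, D ∈ 𝓔₀ ∨ D = ⊤)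
    (hseq : IsSepSeq ρ 𝔟₀ 𝒟₀ (monomialIdeal 𝒮) 𝒟) :
    ∃ (ρ' : E' ⟶ E) (𝒟' : List (E'.IdealSheafData × ℕ)),
      (∀ D ∈ boundaryOf 𝒟', D ∈ 𝓔₀ ∨ D = ⊤) ∧ IsSepSeq ρ' 𝔟₀ 𝒟₀ ⊤ 𝒟' ∧ EndSep (⊤ : E'.IdealSheafData) 𝒟' := by
  -- enlarge the family by the unit ideal
  have h𝓔 : HasSNC ((⊤ : E'.IdealSheafData) :: 𝓔₀) :=
    hasSNC_of_forall_mem_or_eq_top h𝓔₀ fun D hD => (List.mem_cons.mp hD).symm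
  obtain ⟨ρ', 𝒟', h𝒟', hseq'⟩ := exists_isSepSeq_top_of_monomial h𝓔 List.mem_cons_self 𝒮
    (fun p hp => ⟨List.mem_cons_of_mem _ (h𝒮 p hp).1, (h𝒮 p hp).2⟩)
    (fun D hD => (h𝒟 D hD).elim (fun h => List.mem_cons_of_mem _ h) fun h => h ▸ List.mem_cons_self) hseq
  exact ⟨ρ', 𝒟', fun D hD => (List.mem_cons.mp (h𝒟' D hD)).symm, hseq', endSep_top 𝒟'⟩

/-! ## §4 The composition Phase A ∘ Phase B (shape of `SeparationBoundary₃` at the junction boundary `𝒟 = []`) -/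

/-- **T6-E2 from its two phases.**  PHASE A (Cossart–Jannsen–Saito with empty boundary, transported into `IsSepSeq` and split
into connected pieces; res-D-pv-054) delivers, from a non-zero locally principal `𝔟` on an integral Noetherian regular excellent
threefold with EMPTY boundary, a MID state on an integral Noetherian regular `E'`; PHASE B (`exists_isSepSeq_endSep_of_mid`)
finishes.  Stated with Phase A as an explicit hypothesis `hA` (its by-name producer lands separately). [cite: CossartJannsenSaito2020, Thm. 1.4]
[cite: Kollar2007, (3.111) Step 3] -/
theorem exists_isSepSeq_endSep_of_phaseA {E : Scheme.{u}} {𝔟 : E.IdealSheafData}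
    (hA : ∃ (E' : Scheme.{u}) (ρ : E' ⟶ E) (_ : IsIntegral E') (_ : IsNoetherian E') (𝓔₀ : List E'.IdealSheafData)
      (𝒮 𝒟 : List (E'.IdealSheafData × ℕ)),
      Scheme.IsRegular E' ∧ HasSNC 𝓔₀ ∧ (∀ p ∈ 𝒮, p.1 ∈ 𝓔₀ ∧ _root_.IsPreconnected (p.1.support : Set E')) ∧
        (∀ D ∈ boundaryOf 𝒟, D ∈ 𝓔₀ ∨ D = ⊤) ∧
        IsSepSeq ρ 𝔟 ([] : List (E.IdealSheafData × ℕ)) (monomialIdeal 𝒮) 𝒟) :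
    ∃ (E' : Scheme.{u}) (ρ : E' ⟶ E) (𝔟' : E'.IdealSheafData) (𝒟' : List (E'.IdealSheafData × ℕ)),
      IsSepSeq ρ 𝔟 ([] : List (E.IdealSheafData × ℕ)) 𝔟' 𝒟' ∧ IsIntegral E' ∧ IsNoetherian E' ∧
        Scheme.IsRegular E' ∧ EndSep 𝔟' 𝒟' := by
  obtain ⟨E', ρ, hint, hnoeth, 𝓔₀, 𝒮, 𝒟, hreg, h𝓔₀, h𝒮, h𝒟, hseq⟩ := hA
  haveI := hnoeth
  obtain ⟨ρ', 𝒟', -, hseq', hend⟩ := exists_isSepSeq_endSep_of_mid h𝓔₀ 𝒮 h𝒮 h𝒟 hseq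
  exact ⟨E', ρ', ⊤, 𝒟', hseq', hint, hnoeth, hreg, hend⟩

end DepthSep

end Summit.ResolutionOfSingularities.ResolutionOfSingularities.Theorems
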